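import Mathlib
import HarnessLib
import Literature.MathematicalPhysics.StatisticalMechanics.TorusFRDStepKernelPair

/-!
# Lemma 8.4 (`ℓ = 1`) for the step kernels `𝒞_{1+q',k+1}`, `𝒞_{1+q,k+1}` of ONE `TorusFRD` package,
# `q, q'` small symmetric ([ABKM19] Lemma 8.4 / Lemma 12.6 (12.52)–(12.53), torus data)

The end-to-end form of the `ℓ = 1` integration property for the renormalisation group of [ABKM19]
on the torus, measured in the norms of the `q = 0` weights: for a package `𝒞_{A,k}` with clauses
(o)–(v) of `GradientFRD.TorusFRD d` (every elliptic `A ∈ 𝓛(½,2)`), the weight tower of Theorem 7.1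
for `𝒞_{1,k}` (`AbkmWeightBounds`), symmetric `q, q'` with `Σ|q_{ij}|, Σ|q'_{ij}| ≤ T₀ ≤ ½`,
`K T₀ ≤ log(1+ρ)` (`ρ < θ̄`), Hölder conjugates `p, q_H` with `p(1+ρ) ≤ 1+ρ''` (`ρ'' < θ̄`), and
`τ ≥ 0` with `K·Σ|q'−q| ≤ log(1+τ)`, `τ(1+τ) ≤ 1/(16 q_H)`:

* **`tayNormLE_fluct_sub_fluct_of_torusFRD`** —
  `‖fluct 𝒞_{1+q',k+1} F − fluct 𝒞_{1+q,k+1} F‖_{k:k+1,X} ≤ b · ℓ · κ^{|X|_k}` for every `k`-polymer `X`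
  and every `T_k^{X*}`-local `C^{r₀}` functional with `‖F‖_{k,X} ≤ b`, where
  `ℓ = (r₀+1)·gaussCompConst(|Λ|, q_H)·τ(1+τ)` and `κ = A𝒫(ρ'')^{1/p}`
  (`TorusFRDStepKernelPair` inputs ∘ `tayNormLE_fluct_sub_fluct_pow_abkm`).

With `τ = e^{K·Σ|q'−q|} − 1` this is `≤ Λ_N · Σ|q'−q|` locally; the global Lipschitz bound on the ball
follows with the crude far-field bound `2·A𝒫^{|X|}` (Lemma 8.4, `ℓ = 0`).  Everything is proved; no
named fact.

## References
* S. Adams, S. Buchholz, R. Kotecký, S. Müller, arXiv:1910.13564, Lemma 7.7, Lemma 8.4, Lemma 12.6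
  [AdamsBuchholzKoteckyMuller2019].
* S. Buchholz, J. Funct. Anal. 275 (2018), Thm 2.4, Thm 4.5 [Buchholz2016].
-/

noncomputable section

namespace Literature.MathematicalPhysics.StatisticalMechanics.GradientRG

open scoped BigOperators
open Real Set Finset MeasureTheory
open Literature.MathematicalPhysics.StatisticalMechanics.GradientFRD
  (fourierCoeff cExt cExt_of_mem IsElliptic IsUnitSymm InShell iterDiff supNorm conv ellOp isElliptic_one
    exists_inShell re_fourierCoeff_zero_of_sum_eq_zero)
open Literature.MathematicalPhysics.StatisticalMechanics.TorusPolymer (IsPolymer numBlocks)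
open Literature.MathematicalPhysics.QuantumFieldTheory

variable {d M : ℕ} [NeZero M]

section Package

variable {L N Mord R n ñ : ℕ} {θbar lam μ δ₁ δ₀ A𝒫 : ℝ}
    {𝒞 : Matrix (Fin d) (Fin d) ℝ → ℕ → (Fin d → ZMod M) → ℝ} {Mc : ℕ → ℝ}
    {Cα : (Fin d → ℕ) → ℕ → ℝ} {c C : ℝ} {Cℓ : ℕ → ℝ}

/-- **[ABKM19] Lemma 8.4 (`ℓ = 1`, crude volume-dependent form) for the step kernels `𝒞_{1+q',k+1}`,
`𝒞_{1+q,k+1}` of one `TorusFRD` package**, measured in the norms of the `q = 0` weights: for symmetric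
`q, q'` with `Σ|q_{ij}|, Σ|q'_{ij}| ≤ T₀ ≤ ½`, `K T₀ ≤ log(1+ρ)` (`ρ < θ̄`), Hölder conjugates `p, q_H` with
`p(1+ρ) ≤ 1+ρ''` (`ρ'' < θ̄`), and `τ ≥ 0` with `K·Σ|q'−q| ≤ log(1+τ)`, `τ(1+τ) ≤ 1/(16 q_H)`:
`‖fluct 𝒞_{1+q'} F − fluct 𝒞_{1+q} F‖_{k:k+1,X} ≤ b · ℓ · κ^{|X|_k}` for every `k`-polymer `X` and every
`T_k^{X*}`-local `C^{r₀}` functional with `‖F‖_{k,X} ≤ b`, where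
`ℓ = (r₀+1) · gaussCompConst(|Λ|, q_H) · τ(1+τ)` and `κ = A𝒫(ρ'')^{1/p}`.
[cite: AdamsBuchholzKoteckyMuller2019, Lemma 8.4] -/
theorem tayNormLE_fluct_sub_fluct_of_torusFRD
    (hd : 3 ≤ d) (hMord : 1 ≤ Mord) (hMR : Mord ≤ R) (hLodd : Odd L) (hL : 2 ^ (d + 3) + 16 * R ≤ L)
    (hθbar : 0 < θbar) (hlam : 0 < lam) (hn : 2 * Mord ≤ n) (hn2 : 2 ≤ n) (hnñ : n ≤ ñ)
    (hc : 0 < c) (hC1 : 0 ≤ Cℓ 1)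
    (hallA : ∀ A : Matrix (Fin d) (Fin d) ℝ, IsElliptic (1 / 2 : ℝ) 2 A →
        (∀ k, 1 ≤ k → k ≤ N + 1 →
          ∑ x : Fin d → ZMod M, 𝒞 A k x = 0 ∧ ∀ x, 𝒞 A k (-x) = 𝒞 A k x) ∧
        (∀ k, 1 ≤ k → k ≤ N + 1 → ∀ φ : (Fin d → ZMod M) → ℝ, ∑ x, φ x = 0 →
          0 ≤ ∑ x, ∑ y, φ x * 𝒞 A k (x - y) * φ y) ∧
        (∀ φ : (Fin d → ZMod M) → ℝ, ∑ x, φ x = 0 →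
          ellOp A (conv (fun x => ∑ k ∈ Finset.Icc 1 (N + 1), 𝒞 A k x) φ) = φ) ∧
        (∀ k, 1 ≤ k → k ≤ N → Mc k ≤ 0 ∧
          ∀ x : Fin d → ZMod M, ((L : ℝ) ^ k) / 2 ≤ (supNorm x : ℝ) →
            𝒞 A k x = Mc k) ∧
        (∀ k, 1 ≤ k → k ≤ N + 1 → ∀ B : Matrix (Fin d) (Fin d) ℝ, IsUnitSymm B →
          (∃ ε : ℝ, 0 < ε ∧ ∀ x : Fin d → ZMod M,
            ContDiffOn ℝ ⊤ (fun s : ℝ => 𝒞 (A + s • B) k x) (Set.Ioo (-ε) ε)) ∧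
          ∀ α : Fin d → ℕ, ∑ i, α i ≤ n → ∀ ℓ : ℕ, ∀ x : Fin d → ZMod M,
            abs (iteratedDeriv ℓ (fun s : ℝ => iterDiff α (𝒞 (A + s • B) k) x) 0)
              ≤ Cα α ℓ / (L : ℝ) ^ ((k - 1) * (d - 2 + ∑ i, α i))) ∧
        (∀ k, 1 ≤ k → k ≤ N + 1 → ∀ j : ℕ, ∀ κ : Fin d → ZMod M, κ ≠ 0 → InShell L j κ →
          (j < k →
            c / (L : ℝ) ^ (2 * (d + ñ) + 1) * (L : ℝ) ^ (2 * j)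
                / (L : ℝ) ^ ((k - j) * (d - 1 + n)) ≤ (fourierCoeff (𝒞 A k) κ).re ∧
            ‖fourierCoeff (𝒞 A k) κ‖
              ≤ C * (L : ℝ) ^ (2 * (d + ñ) + 1) * (L : ℝ) ^ (2 * j)
                  / (L : ℝ) ^ ((k - j) * (d - 1 + n))) ∧
          (k ≤ j →
            c / (L : ℝ) ^ (2 * (d + ñ) + 1) * (L : ℝ) ^ (2 * k)
                ≤ (fourierCoeff (𝒞 A k) κ).re ∧
            ‖fourierCoeff (𝒞 A k) κ‖ ≤ C * (L : ℝ) ^ (2 * k)) ∧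
          ∀ B : Matrix (Fin d) (Fin d) ℝ, IsUnitSymm B → ∀ ℓ : ℕ, 1 ≤ ℓ →
            (j < k →
              ‖iteratedDeriv ℓ (fun s : ℝ => fourierCoeff (𝒞 (A + s • B) k) κ) 0‖
                ≤ Cℓ ℓ * (L : ℝ) ^ (2 * (d + ñ) + 1) * (L : ℝ) ^ (2 * j)
                    / (L : ℝ) ^ ((k - j) * (d - 1 + ñ))) ∧
            (k ≤ j →
              ‖iteratedDeriv ℓ (fun s : ℝ => fourierCoeff (𝒞 (A + s • B) k) κ) 0‖
                ≤ Cℓ ℓ * (L : ℝ) ^ (2 * k))))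
    (hB : AbkmWeightBounds L N Mord R n θbar lam μ δ₁ δ₀ A𝒫 (fun j => 𝒞 1 j)
      (abkmWeightData L N Mord R θbar (schedDelta δ₀ δ₁ N) fun j => 𝒞 1 j))
    {k : ℕ} (hk : k + 1 ≤ N + 1) {ρ : ℝ} (hρ0 : 0 ≤ ρ) (hρ : ρ < θbar)
    {T₀ : ℝ} (hT₀ : T₀ ≤ 1 / 2) (hKT₀ : shellRatioConst c (Cℓ 1) (L : ℝ) d ñ * T₀ ≤ Real.log (1 + ρ))
    {q q' : Matrix (Fin d) (Fin d) ℝ} (hq : q.IsSymm) (hq' : q'.IsSymm)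
    (hqT : ∑ i, ∑ j, |q i j| ≤ T₀) (hq'T : ∑ i, ∑ j, |q' i j| ≤ T₀)
    {p qH ρ'' : ℝ} (hpq : p.HolderConjugate qH) (hρ''0 : 0 ≤ ρ'') (hρ'' : ρ'' < θbar)
    (hpρ : p * (1 + ρ) ≤ 1 + ρ'')
    {τ : ℝ} (hτ : 0 ≤ τ)
    (hKT : shellRatioConst c (Cℓ 1) (L : ℝ) d ñ * ∑ i, ∑ j, |(q' - q) i j| ≤ Real.log (1 + τ))
    (hτq : τ * (1 + τ) ≤ 1 / (16 * qH))
    {pT r₀ : ℕ} {h A : ℝ} {X : Finset (Fin d → ZMod M)} (hX : IsPolymer (L ^ k) X)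
    {F : ((Fin d → ZMod M) → ℝ) → ℂ} {b : ℝ} (hb : 0 ≤ b) (hFd : ContDiff ℝ r₀ F)
    (hFloc : IsGaugeLocal ((abkmNormParams L N Mord R pT r₀ h θbar A (schedDelta δ₀ δ₁ N)
      fun j => 𝒞 1 j).gauge k X) F)
    (hF : TayNormLE ((abkmNormParams L N Mord R pT r₀ h θbar A (schedDelta δ₀ δ₁ N) fun j => 𝒞 1 j).gauge k X)
      r₀ ((abkmWeightData L N Mord R θbar (schedDelta δ₀ δ₁ N) fun j => 𝒞 1 j).weight k X) F b) :
    TayNormLE ((abkmNormParams L N Mord R pT r₀ h θbar A (schedDelta δ₀ δ₁ N) fun j => 𝒞 1 j).gauge k X) r₀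
      ((abkmWeightData L N Mord R θbar (schedDelta δ₀ δ₁ N) fun j => 𝒞 1 j).midWeight k X)
      (fluct (𝒞 ((1 : Matrix (Fin d) (Fin d) ℝ) + q') (k + 1)) F -
        fluct (𝒞 ((1 : Matrix (Fin d) (Fin d) ℝ) + q) (k + 1)) F)
      (b * ((r₀ + 1) * gaussCompConst (Fintype.card (Fin d → ZMod M)) qH * (τ * (1 + τ))) *
        (weightIntConstRho θbar ρ'' (traceConst d Mord R lam (derivSum d n fun θ' _ => Cα θ' 0)) ^ (1 / p)) ^
          numBlocks (L ^ k) X) := by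
  have h8 : 8 ≤ 2 ^ (d + 3) := by
    calc 8 = 2 ^ 3 := by norm_num
      _ ≤ 2 ^ (d + 3) := Nat.pow_le_pow_right (by norm_num) (by omega)
  have hL2 : 2 ≤ L := by omega
  have hp0 : 0 ≤ p := by linarith [hpq.lt]
  have hq2 : ∑ i, ∑ j, |q i j| ≤ 1 / 2 := hqT.trans hT₀
  have hq'2 : ∑ i, ∑ j, |q' i j| ≤ 1 / 2 := hq'T.trans hT₀
  have hellq : IsElliptic (1 / 2 : ℝ) 2 ((1 : Matrix (Fin d) (Fin d) ℝ) + q) :=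
    isElliptic_one_add_of_entrySum_le hq hq2
  have hellq' : IsElliptic (1 / 2 : ℝ) 2 ((1 : Matrix (Fin d) (Fin d) ℝ) + q') :=
    isElliptic_one_add_of_entrySum_le hq' hq'2
  have hSa := stepKernelBounds_one_add_of_torusFRD hd hMord hMR hLodd hL hθbar hlam hn hn2 hnñ hc hC1 hallA hB hk
    hρ0 hρ hT₀ hKT₀ hq' hq'T
  have hSb := stepKernelBounds_one_add_of_torusFRD hd hMord hMR hLodd hL hθbar hlam hn hn2 hnñ hc hC1 hallA hB hk
    hρ0 hρ hT₀ hKT₀ hq hqT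
  have hSp := stepKernelBounds_const_mul_one_add_of_torusFRD hd hMord hMR hLodd hL hθbar hlam hn hn2 hnñ hc hC1
    hallA hB hk hρ0 hT₀ hKT₀ hq hqT hp0 hρ''0 hρ'' hpρ
  have hA𝒫p : 0 ≤ weightIntConstRho θbar ρ'' (traceConst d Mord R lam (derivSum d n fun θ' _ => Cα θ' 0)) :=
    zero_le_one.trans (one_le_weightIntConstRho hθbar hρ''0 hρ''
      (traceConst_nonneg d Mord R hlam.le (derivSum_nonneg d n _)))
  have hoa := (hallA _ hellq').1 (k + 1) (by omega) hk
  have hob := (hallA _ hellq).1 (k + 1) (by omega) hk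
  have hposa : ∀ κ : Fin d → ZMod M, κ ≠ 0 →
      0 < (fourierCoeff (𝒞 ((1 : Matrix (Fin d) (Fin d) ℝ) + q') (k + 1)) κ).re := fun κ hκ =>
    re_fourierCoeff_pos_of_torusFRD (hallA _ hellq').2.2.2.2.2 hc hL2 (by omega) hk hκ
  have hposb : ∀ κ : Fin d → ZMod M, κ ≠ 0 →
      0 < (fourierCoeff (𝒞 ((1 : Matrix (Fin d) (Fin d) ℝ) + q) (k + 1)) κ).re := fun κ hκ =>
    re_fourierCoeff_pos_of_torusFRD (hallA _ hellq).2.2.2.2.2 hc hL2 (by omega) hk hκ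
  have hcmp := abs_re_fourierCoeff_one_add_sub_le_of_torusFRD (fun A hA => (hallA A hA).1)
    (fun A hA => (hallA A hA).2.2.2.2.1) (fun A hA => (hallA A hA).2.2.2.2.2) hc hC1 hL2 hnñ hq hq' hq2 hq'2
    (k := k + 1) (by omega) hk hτ hKT
  exact tayNormLE_fluct_sub_fluct_pow_abkm hB hSa hSb hpq hSp hA𝒫p hoa.2 hob.2 hoa.1 hob.1 hposa hposb
    (δ := τ * (1 + τ)) (by positivity) hτq hcmp hX hb hFd hFloc hF


end Package

end Literature.MathematicalPhysics.StatisticalMechanics.GradientRG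

end
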